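import Summits.ResolutionOfSingularities.ResolutionOfSingularities.Theorems.WildConesCampaignW46ForcedAtomExists
import Summits.ResolutionOfSingularities.ResolutionOfSingularities.Theorems.MarkedTransferCampaignW46MohWindowCurveInstance
import Summits.ResolutionOfSingularities.ResolutionOfSingularities.Theorems.MarkedTransferCampaignW46MohWindowSurfaceFormalCoordinates
import Literature.AlgebraicGeometry.Resolution.AlterationsFormalCoordinates
import Literature.AlgebraicGeometry.Resolution.OriginLocalRing
import HarnessLib

/-!
# [OURS · L1 W4.6, rung (i)] KERNEL NON-VACUITY WITNESS for the forced-atom regime: the K4.6 cusp family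
# `((y^p + xⁿ)·𝒪, p)`, `p ≤ n`, `p ∤ n`, on the affine plane lies in `CampaignW46.Regime.forcedAtom 1`
# (cell res-hironaka, LADDER-RESOLUTION rung L, D-0089; slot W4.6, seat res-L1-s46-pv-2 gen 3; host route `WildCones`,
# crux `ClassicalRegimes` stmt-ResolutionOfSingularities-16884, `--supports … --as helper`)

HONEST FRAMING. Everything here is OURS: kernel theorems about ONE explicit family of typed states, assembled from TREE
theorems — res-L1-s46-pv-13's scheme-level cusp state on `𝔸²_K` (`CampaignW46.CuspPlane.sing_eq`, `mem_sing_iff`,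
`stalkIdeal_eq_span`, `isStandard`, `sing_nonempty`; `Theorems/MarkedTransferCampaignW46MohWindowCurveInstance.lean`),
the lane-Lib model of the plane (`U82Gap.amb`, `U82Gap.cAt`, `span_range_cAt`, `spanFinrank_maximalIdeal_stalk`,
`isLocAx`; `Proofs/S16Proof/U82p3fModel.lean`), Cohen's structure theorem with PRESCRIBED regular system of parameters
(`exists_ringEquiv_adicCompletion_mvPowerSeries_of_rsop`, `Literature/AlgebraicGeometry/Resolution/AlterationsFormalCoordinates.lean`,
[Matsumura1987] Thm. 29.7 with 28.3 (ii)), Mathlib's `IsLocalization.AtPrime.equivQuotMaximalIdeal` (the residue field of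
the origin is `K`), and this seat's `Regime.forcedAtom_of_exists` (p520554). The manuscript enters only through the typed
CANDIDATE carriers of row 001 (`AmbientDatum`, `IdealExponent`, `.sing`, `IsStandard`) and the OURS regime of
res-L1-type-o1 (`Regime.forcedAtom`, `ForcedAtomTerminates`, p517839); NOTHING here is a statement of H. Hironaka's
manuscript [Hironaka2017]; no FACT-LIST premise. AI review is weaker than expert review.

## What is proved (answers VACUITY (a) of `Theorems/WildConesCampaignW46ForcedAtomRegime.lean`: «an in-kernel state
## witness is NOT constructed in this file»)

* §1 coefficient level, ONE variable `u` (`p ∤ n`): the state `c₀ = «−uⁿ»` of route `WildCones`' calculus has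
  `ser p 1 K c₀ = −uⁿ` (`ser_negPow`) and is ISOLATED, `Isol p 1 K c₀` (`isol_negPow`: the Milnor algebra is
  `K⟦u⟧/(u^{n−1})`, finite; `maximalIdeal_pow_le_span_X_pow`).
* §2 the origin `ξ` of `𝔸²_K = U82Gap.amb p K`: `𝒪̂_{𝔸²,ξ} ≃+* K⟦z,u⟧` with `y ↦ z = X none`, `x ↦ u = X (some 0)`
  (`exists_presentation_origin`; Cohen coordinates, residue field `K` via `equivQuotMaximalIdeal`).
* §3 `CampaignW46.CuspPlane.regime_forcedAtom`: for every PERFECT field `K` of characteristic `p` and every `n` with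
  `p ≤ n`, `p ∤ n`, the standard state `E_n = ((y^p + xⁿ)·𝒪, p)` on `𝔸²_K` lies in `Regime.forcedAtom 1` (its only
  singular point is the origin, of embedding dimension `2`, where `J_ξ = (y^p + xⁿ)` is presented by the isolated atom
  `z^p − (−uⁿ)`); `exists_singular_state_forcedAtom`: the regime contains a STANDARD state with NON-EMPTY singular locus,
  over every perfect field; `forcedAtomTerminates_one_and_inhabited`: over an algebraically closed `K`, o1's rung
  `ForcedAtomTerminates p K 1` HOLDS (this seat's p516034 via `forcedAtomTerminates_holds`) AND its regime is inhabited
  by the whole registered K4.6 family `y^p + xⁿ`, `p ∤ n`, `n ≥ p` (res-L0-k46) — the rung is not a statement about the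
  empty regime.

References: res-L1-s46-pv-13 (p498082); the witness pattern of res-type-008 (`…W46FiniteExitBoundWitness.lean`); U82Gap
(lane Lib); this seat's p516034 / p520554; res-L1-type-o1 p517839. [cite: Matsumura1987, Thm. 29.7] [folklore]
-/

noncomputable section

-- single-problem summit: the doubled namespace component `ResolutionOfSingularities` is forced
set_option linter.dupNamespace false

open scoped BigOperators Classical
open MvPowerSeries IsLocalRing
open CategoryTheory AlgebraicGeometry TopologicalSpace

namespace Summit.ResolutionOfSingularities.ResolutionOfSingularities.Theorems

namespace CampaignW46.CuspPlane

open Literature.AlgebraicGeometry.Resolution Scheme.IdealSheafData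
open Literature.AlgebraicGeometry.Hironaka2017.S02Preliminaries
open Literature.AlgebraicGeometry.Hironaka2017.SpecOrders
open Literature.AlgebraicGeometry.Hironaka2017.S16Proof
open Literature.AlgebraicGeometry.Hironaka2017.Datum
open WildCones

variable (p : ℕ) (K : Type) [Field K]

/-! ## §1 Coefficient level: the one-variable state `−uⁿ` -/

/-- The cleaned series of the state `A ↦ [A 0 = n] · (−1)` is `−uⁿ` when `p ∤ n`. [folklore] -/
theorem ser_negPow {n : ℕ} (hn : ¬ p ∣ n) :
    ser p 1 K (fun A : Fin 1 → ℕ => if A 0 = n then (-1 : K) else 0) =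
      -((MvPowerSeries.X 0 : MvPowerSeries (Fin 1) K) ^ n) := by
  ext A
  rw [map_neg, coeff_X_pow]
  change clean p 1 K (fun A : Fin 1 → ℕ => if A 0 = n then (-1 : K) else 0) ⇑A = _
  simp only [clean]
  by_cases hA : A 0 = n
  · have hA' : A = Finsupp.single 0 n := Finsupp.ext fun i => by
      rw [Subsingleton.elim i 0, Finsupp.single_eq_same, hA]
    have hnot : ¬ ∀ j : Fin 1, p ∣ (⇑A) j := fun h => hn (hA ▸ h 0)
    rw [if_neg hnot, if_pos hA, if_pos hA']
  · have hA' : A ≠ Finsupp.single 0 n := fun h => hA (by rw [h, Finsupp.single_eq_same])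
    rw [if_neg hA', if_neg hA]
    split_ifs <;> simp

/-- In one variable, `𝔪^N ≤ (u^N)` in `K⟦u⟧`. [folklore] -/
theorem maximalIdeal_pow_le_span_X_pow (N : ℕ) :
    maximalIdeal (MvPowerSeries (Fin 1) K) ^ N ≤
      Ideal.span {(MvPowerSeries.X 0 : MvPowerSeries (Fin 1) K) ^ N} := by
  intro f hf
  rw [Ideal.mem_span_singleton, X_pow_dvd_iff]
  intro m hm
  have hord := Literature.RingTheory.MvPowerSeries.Jets.le_order_of_mem_maximalIdeal_pow hf
  apply coeff_of_lt_order
  refine lt_of_lt_of_le ?_ hord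
  have hdeg : m.degree = m 0 := by
    conv_lhs => rw [show m = Finsupp.single 0 (m 0) from Finsupp.ext fun i => by
      rw [Subsingleton.elim i 0, Finsupp.single_eq_same]]
    exact Finsupp.degree_single _ _
  rw [hdeg]
  exact_mod_cast hm

/-- The gradient ideal of the state `−uⁿ⁺¹... ` : for `n = m + 1` with `p ∤ n`, `jac = (u^m)`. [folklore] -/
theorem jac_negPow [CharP K p] {m : ℕ} (hn : ¬ p ∣ m + 1) :
    jac p 1 K (fun A : Fin 1 → ℕ => if A 0 = m + 1 then (-1 : K) else 0) =
      Ideal.span {(MvPowerSeries.X 0 : MvPowerSeries (Fin 1) K) ^ m} := by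
  have hpd : WildCones.pd 1 K 0 (ser p 1 K (fun A : Fin 1 → ℕ => if A 0 = m + 1 then (-1 : K) else 0)) =
      -(((m + 1 : ℕ) : MvPowerSeries (Fin 1) K) * (MvPowerSeries.X 0 : MvPowerSeries (Fin 1) K) ^ m) := by
    rw [ser_negPow p K hn, AtomGerm.pd_eq_pd, map_neg, Literature.RingTheory.MvPowerSeries.pd_pow_succ,
      Literature.RingTheory.MvPowerSeries.pd_X, if_pos rfl, mul_one]
  have hrange : Set.range (fun i : Fin 1 =>
      WildCones.pd 1 K i (ser p 1 K (fun A : Fin 1 → ℕ => if A 0 = m + 1 then (-1 : K) else 0))) =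
      {-(((m + 1 : ℕ) : MvPowerSeries (Fin 1) K) * (MvPowerSeries.X 0 : MvPowerSeries (Fin 1) K) ^ m)} := by
    rw [← hpd]
    ext g
    simp only [Set.mem_range, Set.mem_singleton_iff]
    constructor
    · rintro ⟨i, rfl⟩
      rw [Subsingleton.elim i 0]
    · rintro rfl
      exact ⟨0, rfl⟩
  have hunit : IsUnit (((m + 1 : ℕ) : MvPowerSeries (Fin 1) K)) := by
    rw [← map_natCast (MvPowerSeries.C (σ := Fin 1) (R := K))]
    refine IsUnit.map _ (isUnit_iff_ne_zero.mpr fun h => hn ?_)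
    exact (CharP.cast_eq_zero_iff K p (m + 1)).mp h
  change Ideal.span (Set.range fun i : Fin 1 =>
    WildCones.pd 1 K i (ser p 1 K (fun A : Fin 1 → ℕ => if A 0 = m + 1 then (-1 : K) else 0))) = _
  rw [hrange, Ideal.span_singleton_neg, Ideal.span_singleton_mul_left_unit hunit]

/-- The state `−uⁿ` (`p ∤ n`) is ISOLATED: its Milnor algebra `K⟦u⟧/(n u^{n−1}) = K⟦u⟧/(u^{n−1})` is finite over `K`.
[folklore] -/
theorem isol_negPow [CharP K p] {n : ℕ} (hn : ¬ p ∣ n) :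
    Isol p 1 K (fun A : Fin 1 → ℕ => if A 0 = n then (-1 : K) else 0) := by
  have hn0 : n ≠ 0 := by
    rintro rfl
    exact hn (dvd_zero p)
  obtain ⟨m, rfl⟩ : ∃ m, n = m + 1 := ⟨n - 1, by omega⟩
  change Module.Finite K (MvPowerSeries (Fin 1) K ⧸
    jac p 1 K (fun A : Fin 1 → ℕ => if A 0 = m + 1 then (-1 : K) else 0))
  rw [jac_negPow p K hn, AtomGerm.finite_quotient_iff_exists_pow_le]
  exact ⟨m, maximalIdeal_pow_le_span_X_pow K m⟩

/-! ## §2 The origin of the plane in Cohen coordinates -/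

/-- **Formal coordinates at the origin of the plane, with coefficients in `K`**: a ring isomorphism
`𝒪̂_{𝔸²,ξ} ≃+* K⟦z,u⟧` sending the germ of `y` to `z = X none` and the germ of `x` to `u = X (some 0)` (Cohen's structure
theorem with the prescribed regular system of parameters `(y, x)`; the residue field of the `K`-rational origin is `K`).
[cite: Matsumura1987, Thm. 29.7] -/
theorem exists_presentation_origin [Fact p.Prime] [CharP K p] :
    ∃ E₀ : AdicCompletion (maximalIdeal ((U82Gap.Z K).presheaf.stalk (U82Gap.ξ K)))
        ((U82Gap.Z K).presheaf.stalk (U82Gap.ξ K)) ≃+* MvPowerSeries (Option (Fin 1)) K,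
      E₀ (algebraMap _ _ (U82Gap.cAt (U82Gap.ξ K) 0)) = MvPowerSeries.X none ∧
      E₀ (algebraMap _ _ (U82Gap.cAt (U82Gap.ξ K) 1)) = MvPowerSeries.X (some 0) := by
  haveI hreg : IsRegularLocalRing ((U82Gap.Z K).presheaf.stalk (U82Gap.ξ K)) :=
    U82Gap.isRegularLocalRing_stalk (U82Gap.ξ K)
  -- a field inside the stalk (the image of `K`)
  obtain ⟨k₀, hk₀⟩ := AmbientDatum.exists_isField_subring_stalk (U82Gap.amb p K) (U82Gap.ξ K)
  -- the residue field of the origin is `K`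
  haveI : IsLocalization.AtPrime ((U82Gap.Z K).presheaf.stalk (U82Gap.ξ K)) (originIdeal K 2) :=
    U82Gap.isLocAx (U82Gap.ξ K)
  let ι : ResidueField ((U82Gap.Z K).presheaf.stalk (U82Gap.ξ K)) ≃+* K :=
    (IsLocalization.AtPrime.equivQuotMaximalIdeal (originIdeal K 2)
      ((U82Gap.Z K).presheaf.stalk (U82Gap.ξ K))).symm.trans
      (RingHom.quotientKerEquivOfSurjective (Literature.AlgebraicGeometry.Resolution.constantCoeff_surjective K 2))
  -- `dim 𝒪_{𝔸²,ξ} = 2`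
  have hd : ringKrullDim ((U82Gap.Z K).presheaf.stalk (U82Gap.ξ K)) = (2 : ℕ) := by
    rw [← IsRegularLocalRing.spanFinrank_maximalIdeal, U82Gap.spanFinrank_maximalIdeal_stalk rfl]
  obtain ⟨e, he⟩ := @exists_ringEquiv_adicCompletion_mvPowerSeries_of_rsop
    ((U82Gap.Z K).presheaf.stalk (U82Gap.ξ K)) _ hreg k₀ hk₀ K _ ι 2 (U82Gap.cAt (U82Gap.ξ K))
    (U82Gap.span_range_cAt rfl) hd
  refine ⟨e.trans (renameEquiv K (finSuccEquiv 1)).toRingEquiv, ?_, ?_⟩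
  · rw [RingEquiv.trans_apply, he]
    exact (rename_X (⇑(finSuccEquiv 1)) (0 : Fin 2) :
      rename (⇑(finSuccEquiv 1)) (MvPowerSeries.X 0 : MvPowerSeries (Fin 2) K) = _).trans (by rw [finSuccEquiv_zero])
  · rw [RingEquiv.trans_apply, he]
    exact (rename_X (⇑(finSuccEquiv 1)) (1 : Fin 2) :
      rename (⇑(finSuccEquiv 1)) (MvPowerSeries.X 1 : MvPowerSeries (Fin 2) K) = _).trans
        (by rw [show (1 : Fin 2) = (0 : Fin 1).succ from rfl, finSuccEquiv_succ])

/-! ## §3 The cusp family lies in the forced-atom regime -/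

/-- [OURS · L1 W4.6 rung (i) — NON-VACUITY WITNESS; NOT a statement of the manuscript] **The standard state
`E_n = ((y^p + xⁿ)·𝒪, p)` on `𝔸²_K` lies in `Regime.forcedAtom 1`** for every perfect field `K` of characteristic `p` and
every `n ≥ p` with `p ∤ n`: its singular locus is the origin (res-L1-s46-pv-13), of embedding dimension `2`, where
`J_ξ = ((y/1)^p + (x/1)ⁿ)` is carried by the Cohen coordinates `y ↦ z`, `x ↦ u` to the atom `z^p − (−uⁿ)` of the
ISOLATED one-variable state `−uⁿ` of route `WildCones`' calculus. [folklore] -/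
theorem regime_forcedAtom [Fact p.Prime] [CharP K p] [PerfectRing K p] {n : ℕ} (hpn : p ≤ n) (hn : ¬ p ∣ n) :
    Regime.forcedAtom (p := p) (K := K) 1 (U82Gap.amb p K)
      ⟨shf (MvPolynomial (Fin 2) K) (Ideal.span {MvPolynomial.X 1 ^ p + MvPolynomial.X 0 ^ n}), p⟩ := by
  refine Regime.forcedAtom_of_exists _ _ ⟨rfl, ?_, fun ξ hξ => ?_⟩
  · change (⟨shf (MvPolynomial (Fin 2) K) (Ideal.span {MvPolynomial.X 1 ^ p + MvPolynomial.X 0 ^ n}), p⟩ :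
        IdealExponent (U82Gap.Z K)).sing.Subsingleton
    rw [sing_eq p K hpn hn]
    exact Set.subsingleton_singleton
  · have hξ' : ξ = U82Gap.ξ K := (mem_sing_iff p K hpn hn ξ).mp hξ
    subst hξ'
    -- the presentation, stated over the model `U82Gap.Z K` (definitionally the ambient scheme of `U82Gap.amb p K`)
    have hpres : ∃ (E₀ : AdicCompletion (maximalIdeal ((U82Gap.Z K).presheaf.stalk (U82Gap.ξ K)))
          ((U82Gap.Z K).presheaf.stalk (U82Gap.ξ K)) ≃+* MvPowerSeries (Option (Fin 1)) K)
        (f₀ : (U82Gap.Z K).presheaf.stalk (U82Gap.ξ K)) (c₀ : (Fin 1 → ℕ) → K) (w₀ : MvPowerSeries (Option (Fin 1)) K),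
        stalkIdeal (shf (MvPolynomial (Fin 2) K) (Ideal.span {MvPolynomial.X 1 ^ p + MvPolynomial.X 0 ^ n}))
            (U82Gap.ξ K) = Ideal.span {f₀} ∧ IsUnit w₀ ∧
          E₀ (algebraMap _ _ f₀) = w₀ * ((MvPowerSeries.X none : MvPowerSeries (Option (Fin 1)) K) ^ p -
            rename (some : Fin 1 → Option (Fin 1)) (ser p 1 K c₀)) ∧ Isol p 1 K c₀ := by
      obtain ⟨E₀, h0, h1⟩ := exists_presentation_origin p K
      refine ⟨E₀, _, _, 1, stalkIdeal_eq_span p K n (U82Gap.ξ K), isUnit_one, ?_, isol_negPow p K hn⟩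
      simp only [map_add, map_pow, h0, h1, ser_negPow p K hn, map_neg, rename_X, one_mul, sub_neg_eq_add]
    have hdim : (maximalIdeal ((U82Gap.Z K).presheaf.stalk (U82Gap.ξ K))).spanFinrank = 1 + 1 := by
      rw [U82Gap.spanFinrank_maximalIdeal_stalk rfl]
    exact ⟨hdim, hpres⟩

/-- [OURS · L1 W4.6 rung (i) — NON-VACUITY; NOT a statement of the manuscript] For every prime `p` and every PERFECT
field `K` of characteristic `p`, the forced-atom regime `Regime.forcedAtom 1` of the typed Th. 16.6 procedure contains
a STANDARD state with NON-EMPTY singular locus (the cusp `((y^p + x^{p+1})·𝒪, p)` on `𝔸²_K`). [folklore] -/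
theorem exists_singular_state_forcedAtom [Fact p.Prime] [CharP K p] [PerfectRing K p] :
    ∃ (A : AmbientDatum p K) (E : IdealExponent A.Z),
      Regime.forcedAtom (p := p) (K := K) 1 A E ∧ E.IsStandard ∧ E.sing.Nonempty := by
  have hp : p.Prime := Fact.out
  have hn : ¬ p ∣ p + 1 := fun h => hp.one_lt.ne' (Nat.dvd_one.mp ((Nat.dvd_add_right (dvd_refl p)).mp h))
  exact ⟨U82Gap.amb p K,
    ⟨shf (MvPolynomial (Fin 2) K) (Ideal.span {MvPolynomial.X 1 ^ p + MvPolynomial.X 0 ^ (p + 1)}), p⟩,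
    regime_forcedAtom p K (Nat.le_succ p) hn, isStandard p K (Nat.succ_le_succ (Nat.zero_le p)),
    sing_nonempty p K (Nat.le_succ p) hn⟩

/-- [OURS · L1 W4.6 rung (i); NOT a statement of the manuscript] **The rung on an inhabited regime.** Over an
algebraically closed field `K` of characteristic `p`: o1's rung `ForcedAtomTerminates p K 1` HOLDS (closed by this seat's
p516034 through `forcedAtomTerminates_holds`) AND the regime `Regime.forcedAtom 1` contains a standard state with
non-empty singular locus — the termination statement is not about the empty regime. [folklore] -/
theorem forcedAtomTerminates_one_and_inhabited [Fact p.Prime] [CharP K p] [IsAlgClosed K] :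
    ForcedAtomTerminates p K 1 ∧
      ∃ (A : AmbientDatum p K) (E : IdealExponent A.Z),
        Regime.forcedAtom (p := p) (K := K) 1 A E ∧ E.IsStandard ∧ E.sing.Nonempty :=
  haveI : PerfectRing K p := PerfectField.toPerfectRing p
  ⟨forcedAtomTerminates_holds Nat.one_pos, exists_singular_state_forcedAtom p K⟩

end CampaignW46.CuspPlane

end Summit.ResolutionOfSingularities.ResolutionOfSingularities.Theorems

end
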